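import Literature.MathematicalPhysics.QuantumFieldTheory.Balaban1983to89.T3B8Thm2AtMembers
import Summits.QuantumFields.YangMills.Theorems.UnitScaleTiltProp7Thm2SocketOfCoverForm
import Summits.QuantumFields.YangMills.Theorems.UnitScaleTiltProp7SPrintIn19Dict
import HarnessLib

/-!
# S2β · (REG) ∕ (R-3) — «THE COVARIANT OSCILLATION OF THE THM-2 REPRESENTATIVE»: [Balaban1985RegularSpaces] Theorem 2's gradient clause (1.36)₂ read as a
# COVARIANT-OSCILLATION bound along lattice words, generically, and at the members of the T³ families from the named fact `T3B8Thm2AtMembers.B8Thm2AtT3Members`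
# (desk RULING №124∕№124-A; architect item (REG) (R-1)–(R-5); px16 g24 LOCATE)

Cell `ym3-torus` (YM ladder rung R3 = continuum `SU(2)` Yang–Mills on the three-torus at fixed lattice data — a RUNG: NOT d = 4, NOT infinite volume, NOT a mass gap,
NOT Clay).  Width seat `ym3-torus-px13` (gen 29); crux `stmt-QuantumFields-20520`, LINE g18-1 S2β, the c₁ column's residue «SRC-VOL-R» (q1).
`--kind proof --supports stmt-QuantumFields-20520 --as helper`, count-neutral, DEFINITION-FREE (0 `def`, 0 `instance`, 0 `notation`, 0 `sorry`, default heartbeats).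

WHAT IS PROVED (sorry-free; `conjR U X = U·X·U⁻¹`, `hol` = [Balaban1985Averaging] (9) parallel transport along a lattice word, `covDerivFwd` = [Balaban1985RegularSpaces] (1.1)).
§1 ★COVARIANT TELESCOPING (any normed algebra `𝔸`, background `V` with values in `U1 𝔸 = {‖u‖ ≤ 1, ‖u⁻¹‖ ≤ 1}`, any `F : ℤᵈ → 𝔸`, `0 < η`): one letter forward∕backward, then
   `norm_conjR_hol_sub_le`: `(∀ y μ, ‖covDerivFwd η V μ F y‖ ≤ G) → ‖conjR (hol V x w) (F (x + disp w)) − F x‖ ≤ w.length·(η·G)` for EVERY word `w`, and the two-word form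
   `norm_conjR_hol_sub_conjR_hol_le` (`≤ (|w| + |w′|)·(η·G)`) — the shape of the rows' covariant oscillation letter `hOSC` (C₇b ✓p838589), whose gauge `h` is the axial comb
   `axialFn = hol ∘ treeWord` (✓`T4AxialGaugeSmallField.axialGauge_castSite`); `norm_conjR_axialFn_sub_le`: `≤ l1 (x − y)·(η·G)`.
§2 (1.36)₂ READ: `C136T L k η β₀ B₁ B₂ len s U₀ A →` §1's conclusions for every component `fun z => A z κ` with `G = B₁·s·((L^j·η)⁻¹)²`, every `j ≤ k`.
§3 `Concl2Setup P k η β₀ B₁ B₂ len α₀ α₁ U₀ U′ u →` the Thm-2 representative `U₁ = U′^{u⁻¹} = cfgExp η A♯` (self-adjoint torus one-form `A`) obeys (1.36)₁ and §2 with `s = α₀ + α₁`.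
§4 ★THE STATION LETTER.  `oscLetter_of_thm2SetupSUAt`: ONE member `Thm2SetupSUAt (F.P K) 2 (K − n) (eta F n K) β₀ B₁ B₂ c₁ len ⊤` ⟹ for all `0 < α₀, α₁`, `α₀ + α₁ ≤ c₁` and all
   `SU(2)` data `U₀, U′` with (1.33)₁, (1.34), (1.35): `∃ u A`, (1.29) `Restr129T`, `U′^{u⁻¹} = cfgExp η A♯`, (1.36)₁ `‖A♯‖ ≤ B₁·(α₀+α₁)`, and for every `κ`, base `x`, word `w`:
   `‖conjR (hol U₀♯ x w) (A♯ (x + disp w) κ) − A♯ x κ‖ ≤ w.length·(η·(B₁·(α₀+α₁)))` — the `j = K − n` instance, `L^{K−n}·η = 1` (✓`Prop7SPrintIn19.pow_mul_eta`).  Then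
   ★`oscLetter_of_b8Thm2AtT3Members` (CONDITIONAL on the named fact, every `L > 1`, print's big-block floor `k₀ ≤ F.m` carried AS NAMED) and
   ★`oscLetter_of_five_le` (UNCONDITIONAL for every block size `L ≥ 5`, floor `0`, by ✓`UnitScaleTiltProp7Thm2SocketOfCoverForm.hThm2S_body_of_five_le`).

DICTIONARY (RULING №124 R4 ∕ №124-A A4).  station `(F, n < K)` ↦ `P := F.P K`, `k = K − n`, `η = eta F n K = (L⁻¹)^{K−n}`; background `U₀ ↦ cfgPull (toUField U₀) = U₀♯` (periodic
`ℤᵈ` reading from the origin), full field `V·U ↦ toUField (fun b => U′ b * U₀ b)`; `Reg := ⊤` and the floor `k₀ ≤ F.m` are taken AS NAMED (not re-opened); `A` is Thm 2's self-adjoint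
`M₂(ℂ)` one-form with `U₁ = expUnit (I•η•A)`; no `GFData` field is instantiated by `True` here (the `⊤` is the fact's own regularity slot, print p.82∕p.99).

HONEST ∕ HAZARD «GAUGE-REP» (this seat's FINDING 2026-09-01T00:39Z).  The bound is for the THM-2 REPRESENTATIVE `U′^{u⁻¹}` — `u` is the (1.29)-restricted Landau gauge
transformation of the FULL field with the background FIXED (`mgauge`, ✓`B7Eq92Concrete.mgauge_mul`), neither `1` nor small a priori — NOT for an un-gauged relative field such as
the S2β tower's `X i = log(Ū^i·(Ū₀^i)⁻¹)`; for the latter no `o(M)` oscillation bound exists (level `0`, `U₀ = 1`, `ζ` = a block step: covariant oscillation `= M`).  Docking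
into `rows_K5_cov_osc`'s `hOSC` is therefore an identity ONLY at data read at their Thm-2 representative (`u = 1` by uniqueness iff the datum already satisfies (1.29) ∧
(1.36)–(1.39)); the transport of ∇-bounds through `Averaging.iter` ([Balaban1985Averaging] §3) is NOT typed here.  Nothing of Bałaban's analysis is proved: §4's first theorem
is CONDITIONAL on `B8Thm2AtT3Members` ([Balaban1985RegularSpaces] Thm 2 p.83 at the T³ members; UNPROVED at `L = 3`, a theorem for `L ≥ 5` — §4's third theorem); (q1),
(SCT″-c)₁₂₃, LOC‴, GAP♯∘ (`stub_uniformFibreGapOrbit`, registry 3732b7df UNTOUCHED, 0∕5), the five registered stubs, S2β, crux 20520, 19936, 19200, `YM3TorusSU2` — NOT proved;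
no summit statement is proved by a helper; rung R3 — NOT d = 4, NOT infinite volume, NOT a mass gap, NOT Clay; the Yang–Mills mass gap is NOT proved.  Axioms standard.

References: [Balaban1985RegularSpaces] T. Bałaban, CMP **99** (1985) 75–102, (1.1) p.76, (1.29) p.81, (1.33)–(1.38) p.82, Thm 2 + (1.39) p.83; [Balaban1985Averaging] CMP **98**
(1985) 17–51, (9) p.18, (55)–(56) p.27.
-/

set_option autoImplicit false

noncomputable section

namespace Summit.QuantumFields.YangMills.Theorems.FluctuationComparisonRegPrIntLS2BetaCovariantOscillationOfThm2

open Literature.MathematicalPhysics.QuantumFieldTheory.Balaban1983to89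
open B7Prop1Explicit (Letter e hol stepHol disp U1 hol_mem stepHol_mem hol_cons hol_nil disp_cons disp_nil axialFn treeWord l1
  length_treeWord)
open B7Eq78Linearization (conjR conjR_sub conjR_smul_real)
open B8Ineq132 (covDerivFwd conjR_conjR one_conjR norm_conjR_le)
open B7Prop2Explicit (unitaryUnits_le_U1)
open B8Thm2SetupTorus (cfgPull gaugePull toUGauge Thm2SetupSUAt Concl2Setup Restr129T InAxT Hyp135T cfgPull_mem)
open B10Eq27TorusAxialLog (pull toUField)
open B10Eq68TorusRegularity (InSpace)
open T3ContinuumYM3Torus (T3Family)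
open T3SectALandauChart (eta eta_pos)
open T3B8Thm2AtMembers (B8Thm2AtT3Members)
open Summit.QuantumFields.YangMills.Theorems.Prop7Thm2SocketOfCoverForm (hThm2S_body_of_five_le)
open Summit.QuantumFields.YangMills.Theorems.Prop7SPrintIn19 (pow_mul_eta)

/-! ## §1 ★ Covariant telescoping along lattice words -/

section Telescoping

variable {d : ℕ} {𝔸 : Type*} [NormedRing 𝔸] [NormOneClass 𝔸] [NormedAlgebra ℂ 𝔸]

omit [NormOneClass 𝔸] in
/-- **ONE FORWARD LETTER**: `‖R(V(x,μ))F(x + e_μ) − F(x)‖ = η·‖(D^η_{V,μ}F)(x)‖` (`0 ≤ η`; (1.1) solved for the transported value).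
[cite: Balaban1985RegularSpaces, (1.1) p.76] -/
theorem norm_conjR_fwd_sub_eq {η : ℝ} (hη : 0 < η) (V : B7Prop1Explicit.Site d → Fin d → 𝔸ˣ) (μ : Fin d)
    (F : B7Prop1Explicit.Site d → 𝔸) (x : B7Prop1Explicit.Site d) :
    ‖conjR (V x μ) (F (x + e μ)) - F x‖ = η * ‖covDerivFwd η V μ F x‖ := by
  have h : conjR (V x μ) (F (x + e μ)) - F x = η • covDerivFwd η V μ F x := by
    rw [covDerivFwd, smul_smul, mul_inv_cancel₀ hη.ne', one_smul]
  rw [h, norm_smul, Real.norm_of_nonneg hη.le]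

/-- **ONE BACKWARD LETTER**: `‖R(V(x − e_μ, μ))⁻¹F(x − e_μ) − F(x)‖ ≤ η·‖(D^η_{V,μ}F)(x − e_μ)‖` for `V` with values in `U1 𝔸` (transport back across the
bond `⟨x − e_μ, x⟩`: `R(V)⁻¹(R(V)F(x) − η·DF) − F(x) = −η·R(V)⁻¹DF`). [cite: Balaban1985RegularSpaces, (1.1) p.76; Balaban1985Averaging, (9) p.18] -/
theorem norm_conjR_bwd_sub_le {η : ℝ} (hη : 0 < η) {V : B7Prop1Explicit.Site d → Fin d → 𝔸ˣ} (hV : ∀ x κ, V x κ ∈ U1 𝔸) (μ : Fin d)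
    (F : B7Prop1Explicit.Site d → 𝔸) (y : B7Prop1Explicit.Site d) :
    ‖conjR (V y μ)⁻¹ (F y) - F (y + e μ)‖ ≤ η * ‖covDerivFwd η V μ F y‖ := by
  have h1 : conjR (V y μ) (F (y + e μ)) - F y = η • covDerivFwd η V μ F y := by
    rw [covDerivFwd, smul_smul, mul_inv_cancel₀ hη.ne', one_smul]
  have h2 : F y = conjR (V y μ) (F (y + e μ)) - η • covDerivFwd η V μ F y := by rw [← h1]; abel
  have h3 : conjR (V y μ)⁻¹ (F y) - F (y + e μ) = -(η • conjR (V y μ)⁻¹ (covDerivFwd η V μ F y)) := by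
    rw [h2, conjR_sub, conjR_conjR, inv_mul_cancel, one_conjR, conjR_smul_real]; abel
  rw [h3, norm_neg, norm_smul, Real.norm_of_nonneg hη.le]
  exact mul_le_mul_of_nonneg_left (norm_conjR_le ((U1 𝔸).inv_mem (hV y μ)) _) hη.le

/-- **ONE LETTER, EITHER ORIENTATION**: under a uniform bound `‖D^η_{V,μ}F‖ ≤ G` the transport across one letter `l` from `x` moves `F` by at most `η·G`:
`‖R(V(l; x))F(x + l) − F(x)‖ ≤ η·G` (`stepHol` = the bond variable traversed, (9) of [3]). [cite: Balaban1985RegularSpaces, (1.1) p.76; Balaban1985Averaging, (9) p.18] -/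
theorem norm_conjR_stepHol_sub_le {η : ℝ} (hη : 0 < η) {V : B7Prop1Explicit.Site d → Fin d → 𝔸ˣ} (hV : ∀ x κ, V x κ ∈ U1 𝔸)
    {F : B7Prop1Explicit.Site d → 𝔸} {G : ℝ} (hG : ∀ y μ, ‖covDerivFwd η V μ F y‖ ≤ G) (x : B7Prop1Explicit.Site d) (l : Letter d) :
    ‖conjR (stepHol V x l) (F (x + l.vec)) - F x‖ ≤ η * G := by
  obtain ⟨μ, b⟩ := l
  cases b with
  | true =>
    rw [show stepHol V x (μ, true) = V x μ from rfl, Letter.vec_true, norm_conjR_fwd_sub_eq hη]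
    exact mul_le_mul_of_nonneg_left (hG x μ) hη.le
  | false =>
    have hv : x + Letter.vec ((μ, false) : Letter d) = x - e μ := by rw [Letter.vec_false, sub_eq_add_neg]
    have hs : stepHol V x (μ, false) = (V (x - e μ) μ)⁻¹ := by
      simp only [stepHol, hv, Bool.false_eq_true, ↓reduceIte]
    rw [hs, hv]
    have h := norm_conjR_bwd_sub_le hη hV μ F (x - e μ)
    rw [sub_add_cancel] at h
    exact h.trans (mul_le_mul_of_nonneg_left (hG _ μ) hη.le)

/-- ★ **COVARIANT TELESCOPING ALONG A WORD**: under `‖D^η_{V,μ}F‖ ≤ G` everywhere, the value of `F` at the end of ANY lattice word `w` from `x`, transported back to `x`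
along `w` by the background (`R(V(Γ))`, (9) of [3]), differs from `F(x)` by at most `|w|·η·G`:
`‖conjR (hol V x w) (F (x + disp w)) − F x‖ ≤ w.length·(η·G)`. [cite: Balaban1985RegularSpaces, (1.1) p.76, (1.36) p.82; Balaban1985Averaging, (9) p.18] -/
theorem norm_conjR_hol_sub_le {η : ℝ} (hη : 0 < η) {V : B7Prop1Explicit.Site d → Fin d → 𝔸ˣ} (hV : ∀ x κ, V x κ ∈ U1 𝔸)
    {F : B7Prop1Explicit.Site d → 𝔸} {G : ℝ} (hG : ∀ y μ, ‖covDerivFwd η V μ F y‖ ≤ G) :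
    ∀ (x : B7Prop1Explicit.Site d) (w : List (Letter d)), ‖conjR (hol V x w) (F (x + disp w)) - F x‖ ≤ (w.length : ℝ) * (η * G)
  | x, [] => by simp [one_conjR]
  | x, l :: w => by
    have ih := norm_conjR_hol_sub_le hη hV hG (x + l.vec) w
    have hstep := norm_conjR_stepHol_sub_le hη hV hG x l
    rw [hol_cons, disp_cons, ← add_assoc, ← conjR_conjR, List.length_cons, Nat.cast_succ, add_mul, one_mul]
    have hsplit : conjR (stepHol V x l) (conjR (hol V (x + l.vec) w) (F (x + l.vec + disp w))) - F x =
        conjR (stepHol V x l) (conjR (hol V (x + l.vec) w) (F (x + l.vec + disp w)) - F (x + l.vec)) +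
          (conjR (stepHol V x l) (F (x + l.vec)) - F x) := by
      rw [conjR_sub]; abel
    rw [hsplit]
    refine (norm_add_le _ _).trans (add_le_add ?_ hstep)
    exact (norm_conjR_le (stepHol_mem hV x l) _).trans ih

/-- ★ **TWO WORDS FROM ONE BASE** (the shape of the rows' covariant oscillation letter: two bond values read in one gauge `h = R(V(Γ))` rooted at `x`):
`‖conjR (hol V x w) (F (x + disp w)) − conjR (hol V x w′) (F (x + disp w′))‖ ≤ (|w| + |w′|)·η·G`. [cite: Balaban1985RegularSpaces, (1.1) p.76, (1.36) p.82; Balaban1985Averaging, (9) p.18] -/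
theorem norm_conjR_hol_sub_conjR_hol_le {η : ℝ} (hη : 0 < η) {V : B7Prop1Explicit.Site d → Fin d → 𝔸ˣ} (hV : ∀ x κ, V x κ ∈ U1 𝔸)
    {F : B7Prop1Explicit.Site d → 𝔸} {G : ℝ} (hG : ∀ y μ, ‖covDerivFwd η V μ F y‖ ≤ G) (x : B7Prop1Explicit.Site d) (w w' : List (Letter d)) :
    ‖conjR (hol V x w) (F (x + disp w)) - conjR (hol V x w') (F (x + disp w'))‖ ≤ ((w.length : ℝ) + w'.length) * (η * G) := by
  have h1 := norm_conjR_hol_sub_le hη hV hG x w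
  have h2 := norm_conjR_hol_sub_le hη hV hG x w'
  calc ‖conjR (hol V x w) (F (x + disp w)) - conjR (hol V x w') (F (x + disp w'))‖
      = ‖(conjR (hol V x w) (F (x + disp w)) - F x) - (conjR (hol V x w') (F (x + disp w')) - F x)‖ := by congr 1; abel
    _ ≤ ‖conjR (hol V x w) (F (x + disp w)) - F x‖ + ‖conjR (hol V x w') (F (x + disp w')) - F x‖ := norm_sub_le _ _
    _ ≤ (w.length : ℝ) * (η * G) + (w'.length : ℝ) * (η * G) := add_le_add h1 h2
    _ = ((w.length : ℝ) + w'.length) * (η * G) := by ring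

/-- ★ **THE AXIAL-COMB FORM**: in the axial gauge of the background rooted at `y` (`axialFn V y x = hol V y (treeWord (x − y))`, the comb of [3] (22); the torus rows' four-block
`axialGauge` IS this function on its box, ✓`T4AxialGaugeSmallField.axialGauge_castSite`) the gauged value of `F` at `x` differs from `F(y)` by at most `‖x − y‖₁·η·G`.
[cite: Balaban1985RegularSpaces, (1.1) p.76, (1.36) p.82; Balaban1985Averaging, (9) p.18, (22) p.21] -/
theorem norm_conjR_axialFn_sub_le {η : ℝ} (hη : 0 < η) {V : B7Prop1Explicit.Site d → Fin d → 𝔸ˣ} (hV : ∀ x κ, V x κ ∈ U1 𝔸)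
    {F : B7Prop1Explicit.Site d → 𝔸} {G : ℝ} (hG : ∀ y μ, ‖covDerivFwd η V μ F y‖ ≤ G) (y x : B7Prop1Explicit.Site d) :
    ‖conjR (axialFn V y x) (F x) - F y‖ ≤ (l1 (x - y) : ℝ) * (η * G) := by
  have h := norm_conjR_hol_sub_le hη hV hG y (treeWord (x - y))
  rw [B7Prop1Explicit.disp_treeWord, add_sub_cancel, length_treeWord] at h
  exact h

/-- ★ **THE AXIAL-COMB FORM, TWO POINTS**: `‖R(h(x))F(x) − R(h(x′))F(x′)‖ ≤ (‖x − y‖₁ + ‖x′ − y‖₁)·η·G`, `h = axialFn V y` — EXACTLY the left side of the rows' `hOSC` for a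
component of a one-form read at two bond sources `x, x′` of the read cell (their `h·X·h⋆` is `conjR h X` for unitary `h`). [cite: Balaban1985RegularSpaces, (1.36) p.82; Balaban1985Averaging, (9) p.18, (22) p.21] -/
theorem norm_conjR_axialFn_sub_conjR_axialFn_le {η : ℝ} (hη : 0 < η) {V : B7Prop1Explicit.Site d → Fin d → 𝔸ˣ} (hV : ∀ x κ, V x κ ∈ U1 𝔸)
    {F : B7Prop1Explicit.Site d → 𝔸} {G : ℝ} (hG : ∀ y μ, ‖covDerivFwd η V μ F y‖ ≤ G) (y x x' : B7Prop1Explicit.Site d) :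
    ‖conjR (axialFn V y x) (F x) - conjR (axialFn V y x') (F x')‖ ≤ ((l1 (x - y) : ℝ) + l1 (x' - y)) * (η * G) := by
  have h := norm_conjR_hol_sub_conjR_hol_le hη hV hG y (treeWord (x - y)) (treeWord (x' - y))
  rw [B7Prop1Explicit.disp_treeWord, B7Prop1Explicit.disp_treeWord, add_sub_cancel, add_sub_cancel, length_treeWord, length_treeWord] at h
  exact h

end Telescoping

/-! ## §2 (1.36)₂ read: `C136T` ⟹ covariant oscillation of every component of `A` -/

section C136

variable {d : ℕ} {𝔸 : Type*} [NormedRing 𝔸] [NormOneClass 𝔸] [NormedAlgebra ℂ 𝔸]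

/-- **(1.36)₂ AS AN OSCILLATION BOUND**: under `C136T L k η β₀ B₁ B₂ len s U₀ A` (clause (2): `‖D^η_{U₀,μ}A_κ‖ < B₁·s·((Lʲη)⁻¹)²` at every site, every `j ≤ k`), for a `U1`-valued
background and `0 < η`: `‖conjR (hol U₀ x w) (A (x + disp w) κ) − A x κ‖ ≤ |w|·(η·(B₁·s·((Lʲη)⁻¹)²))` for every `κ`, `x`, word `w` and `j ≤ k`.
[cite: Balaban1985RegularSpaces, (1.36) p.82, (1.1) p.76] -/
theorem norm_conjR_hol_sub_le_of_c136T {L k : ℕ} {η β₀ B₁ B₂ : ℝ} {len : B7Prop1Explicit.Site d → ℝ} {s : ℝ}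
    {U₀ : B7Prop1Explicit.Site d → Fin d → 𝔸ˣ} {A : B7Prop1Explicit.Site d → Fin d → 𝔸} (hη : 0 < η) (hU₀ : ∀ x κ, U₀ x κ ∈ U1 𝔸)
    (h36 : B8Thm2TorusAt.C136T L k η β₀ B₁ B₂ len s U₀ A) {j : ℕ} (hj : j ≤ k) (κ : Fin d) (x : B7Prop1Explicit.Site d) (w : List (Letter d)) :
    ‖conjR (hol U₀ x w) (A (x + disp w) κ) - A x κ‖ ≤ (w.length : ℝ) * (η * (B₁ * s * (((L : ℝ) ^ j * η)⁻¹) ^ 2)) :=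
  norm_conjR_hol_sub_le hη hU₀ (F := fun z => A z κ) (fun y μ => (h36.2.1 j hj y μ κ).le) x w

/-- **(1.36)₂ AS AN OSCILLATION BOUND, AXIAL-COMB FORM, TWO POINTS**: `‖R(h(x))A_κ(x) − R(h(x′))A_κ(x′)‖ ≤ (‖x − y‖₁ + ‖x′ − y‖₁)·η·B₁·s·((Lʲη)⁻¹)²`, `h = axialFn U₀ y`.
[cite: Balaban1985RegularSpaces, (1.36) p.82, (1.1) p.76; Balaban1985Averaging, (22) p.21] -/
theorem norm_conjR_axialFn_sub_le_of_c136T {L k : ℕ} {η β₀ B₁ B₂ : ℝ} {len : B7Prop1Explicit.Site d → ℝ} {s : ℝ}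
    {U₀ : B7Prop1Explicit.Site d → Fin d → 𝔸ˣ} {A : B7Prop1Explicit.Site d → Fin d → 𝔸} (hη : 0 < η) (hU₀ : ∀ x κ, U₀ x κ ∈ U1 𝔸)
    (h36 : B8Thm2TorusAt.C136T L k η β₀ B₁ B₂ len s U₀ A) {j : ℕ} (hj : j ≤ k) (κ : Fin d) (y x x' : B7Prop1Explicit.Site d) :
    ‖conjR (axialFn U₀ y x) (A x κ) - conjR (axialFn U₀ y x') (A x' κ)‖ ≤
      ((l1 (x - y) : ℝ) + l1 (x' - y)) * (η * (B₁ * s * (((L : ℝ) ^ j * η)⁻¹) ^ 2)) :=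
  norm_conjR_axialFn_sub_conjR_axialFn_le hη hU₀ (F := fun z => A z κ) (fun y μ => (h36.2.1 j hj y μ κ).le) y x x'

end C136

/-! ## §3 `Concl2Setup` ⟹ the Thm-2 representative's one-form and its oscillation bound -/

section Setup

open scoped Matrix.Norms.L2Operator

variable {P : Params} {N : ℕ} [NeZero N]

/-- The periodic `ℤᵈ` reading `U♯ = cfgPull P U` of a `U(N)` torus configuration takes values in `U1 M_N(ℂ) = {‖u‖ ≤ 1, ‖u⁻¹‖ ≤ 1}` (operator norm; unitary ⊂ `U1`,
✓`B7Prop2Explicit.unitaryUnits_le_U1`) — stated here so that the norm instances are the cell's `Matrix.Norms.L2Operator` ones by name. [cite: Balaban1985Averaging, (8) p.19] -/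
theorem cfgPull_mem_U1 (U : GaugeField P 0 (Matrix.unitaryGroup (Fin N) ℂ)) (z : B7Prop1Explicit.Site P.d) (μ : Fin P.d) :
    cfgPull P U z μ ∈ U1 (Matrix (Fin N) (Fin N) ℂ) := by
  letI : CStarAlgebra (Matrix (Fin N) (Fin N) ℂ) := {}
  exact unitaryUnits_le_U1 (cfgPull_mem U z μ)

/-- **THE THM-2 REPRESENTATIVE AT THE SETUP-TORUS OBJECTS**: from `Concl2Setup P k η β₀ B₁ B₂ len α₀ α₁ U₀ U′ u` ((1.36)–(1.39) for `U₁ = U′^{u⁻¹}`) — a self-adjoint torus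
one-form `A` with `U′^{u⁻¹} = e^{iηA}` on the pullbacks, the sup member (1.36)₁ `‖A♯ x κ‖ ≤ B₁·(α₀+α₁)·(Lʲη)⁻¹` AND, for every `j ≤ k`, direction `κ`, base `x` and word `w`, the
covariant oscillation bound
`‖conjR (hol U₀♯ x w) (A♯ (x + disp w) κ) − A♯ x κ‖ ≤ |w|·η·B₁·(α₀+α₁)·((Lʲη)⁻¹)²` (`U₀♯ = cfgPull P U₀` is unitary-valued, hence in `U1`).
[cite: Balaban1985RegularSpaces, Thm 2 p.83, (1.36) p.82, (1.1) p.76] -/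
theorem oscillation_of_concl2Setup {k : ℕ} {η β₀ B₁ B₂ : ℝ} {len : B7Prop1Explicit.Site P.d → ℝ} {α₀ α₁ : ℝ} (hη : 0 < η)
    {U₀ U' : GaugeField P 0 (Matrix.unitaryGroup (Fin N) ℂ)} {u : GaugeTransf P 0 (Matrix.unitaryGroup (Fin N) ℂ)}
    (h : Concl2Setup P k η β₀ B₁ B₂ len α₀ α₁ U₀ U' u) :
    ∃ A : GaugeField P 0 (Matrix (Fin N) (Fin N) ℂ),
      (∀ b : PBond P 0, IsSelfAdjoint (A b)) ∧
      B7Eq92Concrete.mgauge (cfgPull P U₀) (gaugePull P u)⁻¹ (cfgPull P U') = B8Eq184Proof.cfgExp η (pull A 0) ∧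
      (∀ j, j ≤ k → ∀ (κ : Fin P.d) (x : B7Prop1Explicit.Site P.d), ‖pull A 0 x κ‖ ≤ B₁ * (α₀ + α₁) * ((P.L : ℝ) ^ j * η)⁻¹) ∧
      ∀ j, j ≤ k → ∀ (κ : Fin P.d) (x : B7Prop1Explicit.Site P.d) (w : List (Letter P.d)),
        ‖conjR (hol (cfgPull P U₀) x w) (pull A 0 (x + disp w) κ) - pull A 0 x κ‖ ≤
          (w.length : ℝ) * (η * (B₁ * (α₀ + α₁) * (((P.L : ℝ) ^ j * η)⁻¹) ^ 2)) := by
  obtain ⟨A, hsa, hexp, h36, -, -, -⟩ := h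
  exact ⟨A, hsa, hexp, fun j hj κ x => (h36.1 j hj x κ).le,
    fun j hj κ x w => norm_conjR_hol_sub_le_of_c136T hη (cfgPull_mem_U1 U₀) h36 hj κ x w⟩

end Setup

/-! ## §4 ★ The station letter: at the members of the T³ families -/

section Station

open scoped Matrix.Norms.L2Operator

/-- ★ **THE STATION LETTER FROM ONE MEMBER OF THEOREM 2** (`Thm2SetupSUAt` at `P := F.P K`, `k = K − n`, `η = eta F n K`, regularity slot `⊤`): for all `0 < α₀, α₁` with
`α₀ + α₁ ≤ c₁` and all `SU(2)` data `U₀, U′` on the finest lattice of `F.P K` with (1.33)₁ `InSpace`, (1.34) `InSpace (U′U₀) ∧ InAxT`, (1.35) `Hyp135T`: there are an `SU(2)` gauge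
transformation `u` with (1.29) `Restr129T` and a self-adjoint torus one-form `A` with `U′^{u⁻¹} = cfgExp η A♯`, sup member (1.36)₁ `‖A♯‖ ≤ B₁·(α₀ + α₁)`, whose every
component has covariant oscillation along every lattice word `w` at most `|w|·η·B₁·(α₀ + α₁)` — (1.36)₂ at the top level `j = K − n` (`L^{K−n}·η = 1`, ✓`Prop7SPrintIn19.pow_mul_eta`), transported by §1.  HAZARD «GAUGE-REP»: a statement about `U′^{u⁻¹}`, not `U′`.
[cite: Balaban1985RegularSpaces, Thm 2 p.83, (1.36) p.82, (1.29) p.81, (1.1) p.76] -/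
theorem oscLetter_of_thm2SetupSUAt (F : T3Family) {n K : ℕ} {β₀ B₁ B₂ c₁ : ℝ} {len : B7Prop1Explicit.Site (F.P K).d → ℝ}
    (hT : Thm2SetupSUAt (F.P K) 2 (K - n) (eta F n K) β₀ B₁ B₂ c₁ len (fun _ => True))
    ⦃α₀ α₁ : ℝ⦄ (hα₀ : 0 < α₀) (hα₁ : 0 < α₁) (hle : α₀ + α₁ ≤ c₁)
    (U₀ U' : GaugeField (F.P K) 0 (Matrix.specialUnitaryGroup (Fin 2) ℂ))
    (h33 : InSpace (K - n) (fun _ => (Set.univ : Set (Site (F.P K) 0))) α₀ (eta F n K) (toUField U₀))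
    (h34 : InSpace (K - n) (fun _ => (Set.univ : Set (Site (F.P K) 0))) α₀ (eta F n K) (toUField (fun b => U' b * U₀ b)))
    (hAx : InAxT (F.P K) (K - n) (toUField U₀) (toUField (fun b => U' b * U₀ b)))
    (h35 : Hyp135T (F.P K) (K - n) α₁ (toUField U₀) (toUField U')) :
    ∃ (u : GaugeTransf (F.P K) 0 (Matrix.specialUnitaryGroup (Fin 2) ℂ)) (A : GaugeField (F.P K) 0 (Matrix (Fin 2) (Fin 2) ℂ)),
      Restr129T (F.P K) (K - n) (toUField U₀) (toUGauge (F.P K) 2 u) ∧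
      (∀ b : PBond (F.P K) 0, IsSelfAdjoint (A b)) ∧
      B7Eq92Concrete.mgauge (cfgPull (F.P K) (toUField U₀)) (gaugePull (F.P K) (toUGauge (F.P K) 2 u))⁻¹ (cfgPull (F.P K) (toUField U')) =
        B8Eq184Proof.cfgExp (eta F n K) (pull A 0) ∧
      (∀ (κ : Fin (F.P K).d) (x : B7Prop1Explicit.Site (F.P K).d), ‖pull A 0 x κ‖ ≤ B₁ * (α₀ + α₁)) ∧
      ∀ (κ : Fin (F.P K).d) (x : B7Prop1Explicit.Site (F.P K).d) (w : List (Letter (F.P K).d)),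
        ‖conjR (hol (cfgPull (F.P K) (toUField U₀)) x w) (pull A 0 (x + disp w) κ) - pull A 0 x κ‖ ≤
          (w.length : ℝ) * (eta F n K * (B₁ * (α₀ + α₁))) := by
  obtain ⟨u, ⟨h29, hC⟩, -⟩ := hT hα₀ hα₁ hle U₀ U' h33 trivial h34 hAx h35
  obtain ⟨A, hsa, hexp, hsup, hosc⟩ := oscillation_of_concl2Setup (eta_pos F n K) hC
  refine ⟨u, A, h29, hsa, hexp, fun κ x => ?_, fun κ x w => ?_⟩
  · have h := hsup (K - n) le_rfl κ x
    rwa [pow_mul_eta, inv_one, mul_one] at h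
  · have h := hosc (K - n) le_rfl κ x w
    rwa [pow_mul_eta, inv_one, one_pow, mul_one] at h

/-- ★★ **THE (R-3) LANE LETTER — CONDITIONAL ON THE NAMED FACT** `B8Thm2AtT3Members` ([Balaban1985RegularSpaces] Thm 2 at the members of the T³ families; print's big-block floor
`k₀ ≤ F.m` and the regularity slot `⊤` taken AS NAMED): for every block size `L > 1` there are `k₀` and `B₁, c₁ > 0` such that at every member `(F, n < K)` with `F.L = L`, `k₀ ≤ F.m`, the
conclusion of `oscLetter_of_thm2SetupSUAt` holds with these constants — the covariant oscillation of the Thm-2 representative's one-form along any word `w` is at most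
`|w|·η·B₁·(α₀ + α₁)`.  A `conditional-result`: the hypothesis is UNPROVED at `L = 3` (a theorem for `L ≥ 5`, next declaration).  HAZARD «GAUGE-REP» as in the module docstring.
[cite: Balaban1985RegularSpaces, Thm 2 p.83, (1.36) p.82, (1.29) p.81, (1.1) p.76] -/
theorem oscLetter_of_b8Thm2AtT3Members (hX : B8Thm2AtT3Members) (L : ℕ) (hL : 1 < L) :
    ∃ (k₀ : ℕ) (B₁ c₁ : ℝ), 0 < B₁ ∧ 0 < c₁ ∧ ∀ (F : T3Family), F.L = L → k₀ ≤ F.m → ∀ (n K : ℕ), n < K →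
      ∀ ⦃α₀ α₁ : ℝ⦄, 0 < α₀ → 0 < α₁ → α₀ + α₁ ≤ c₁ →
      ∀ U₀ U' : GaugeField (F.P K) 0 (Matrix.specialUnitaryGroup (Fin 2) ℂ),
        InSpace (K - n) (fun _ => (Set.univ : Set (Site (F.P K) 0))) α₀ (eta F n K) (toUField U₀) →
        InSpace (K - n) (fun _ => (Set.univ : Set (Site (F.P K) 0))) α₀ (eta F n K) (toUField (fun b => U' b * U₀ b)) →
        InAxT (F.P K) (K - n) (toUField U₀) (toUField (fun b => U' b * U₀ b)) →
        Hyp135T (F.P K) (K - n) α₁ (toUField U₀) (toUField U') →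
        ∃ (u : GaugeTransf (F.P K) 0 (Matrix.specialUnitaryGroup (Fin 2) ℂ)) (A : GaugeField (F.P K) 0 (Matrix (Fin 2) (Fin 2) ℂ)),
          Restr129T (F.P K) (K - n) (toUField U₀) (toUGauge (F.P K) 2 u) ∧
          (∀ b : PBond (F.P K) 0, IsSelfAdjoint (A b)) ∧
          B7Eq92Concrete.mgauge (cfgPull (F.P K) (toUField U₀)) (gaugePull (F.P K) (toUGauge (F.P K) 2 u))⁻¹ (cfgPull (F.P K) (toUField U')) =
            B8Eq184Proof.cfgExp (eta F n K) (pull A 0) ∧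
          (∀ (κ : Fin (F.P K).d) (x : B7Prop1Explicit.Site (F.P K).d), ‖pull A 0 x κ‖ ≤ B₁ * (α₀ + α₁)) ∧
          ∀ (κ : Fin (F.P K).d) (x : B7Prop1Explicit.Site (F.P K).d) (w : List (Letter (F.P K).d)),
            ‖conjR (hol (cfgPull (F.P K) (toUField U₀)) x w) (pull A 0 (x + disp w) κ) - pull A 0 x κ‖ ≤
              (w.length : ℝ) * (eta F n K * (B₁ * (α₀ + α₁))) := by
  obtain ⟨k₀, B₁, c₁, hB₁, hc₁, hmem⟩ := hX L hL
  refine ⟨k₀, B₁, c₁, hB₁, hc₁, fun F hF hk₀ n K hnK α₀ α₁ hα₀ hα₁ hle U₀ U' h33 h34 hAx h35 => ?_⟩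
  obtain ⟨β₀, B₂, len, hT⟩ := hmem F hF hk₀ n K hnK
  exact oscLetter_of_thm2SetupSUAt F hT hα₀ hα₁ hle U₀ U' h33 h34 hAx h35

/-- ★★ **THE (R-3) LANE LETTER — UNCONDITIONAL FOR EVERY BLOCK SIZE `L ≥ 5`** (floor `0`): the same conclusion from the tree theorem
✓`UnitScaleTiltProp7Thm2SocketOfCoverForm.hThm2S_body_of_five_le` (lit-balaban's binder-free cover form of [B8] Thm 2, `L = ℓ + 1`, `4 ≤ ℓ`; even `L` carry no member).  OPEN only at `L = 3`.
[cite: Balaban1985RegularSpaces, Thm 2 p.83, (1.36) p.82, (1.29) p.81, (1.1) p.76] -/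
theorem oscLetter_of_five_le (L : ℕ) (hL5 : 5 ≤ L) :
    ∃ (B₁ c₁ : ℝ), 0 < B₁ ∧ 0 < c₁ ∧ ∀ (F : T3Family), F.L = L → ∀ (n K : ℕ), n < K →
      ∀ ⦃α₀ α₁ : ℝ⦄, 0 < α₀ → 0 < α₁ → α₀ + α₁ ≤ c₁ →
      ∀ U₀ U' : GaugeField (F.P K) 0 (Matrix.specialUnitaryGroup (Fin 2) ℂ),
        InSpace (K - n) (fun _ => (Set.univ : Set (Site (F.P K) 0))) α₀ (eta F n K) (toUField U₀) →
        InSpace (K - n) (fun _ => (Set.univ : Set (Site (F.P K) 0))) α₀ (eta F n K) (toUField (fun b => U' b * U₀ b)) →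
        InAxT (F.P K) (K - n) (toUField U₀) (toUField (fun b => U' b * U₀ b)) →
        Hyp135T (F.P K) (K - n) α₁ (toUField U₀) (toUField U') →
        ∃ (u : GaugeTransf (F.P K) 0 (Matrix.specialUnitaryGroup (Fin 2) ℂ)) (A : GaugeField (F.P K) 0 (Matrix (Fin 2) (Fin 2) ℂ)),
          Restr129T (F.P K) (K - n) (toUField U₀) (toUGauge (F.P K) 2 u) ∧
          (∀ b : PBond (F.P K) 0, IsSelfAdjoint (A b)) ∧
          B7Eq92Concrete.mgauge (cfgPull (F.P K) (toUField U₀)) (gaugePull (F.P K) (toUGauge (F.P K) 2 u))⁻¹ (cfgPull (F.P K) (toUField U')) =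
            B8Eq184Proof.cfgExp (eta F n K) (pull A 0) ∧
          (∀ (κ : Fin (F.P K).d) (x : B7Prop1Explicit.Site (F.P K).d), ‖pull A 0 x κ‖ ≤ B₁ * (α₀ + α₁)) ∧
          ∀ (κ : Fin (F.P K).d) (x : B7Prop1Explicit.Site (F.P K).d) (w : List (Letter (F.P K).d)),
            ‖conjR (hol (cfgPull (F.P K) (toUField U₀)) x w) (pull A 0 (x + disp w) κ) - pull A 0 x κ‖ ≤
              (w.length : ℝ) * (eta F n K * (B₁ * (α₀ + α₁))) := by
  obtain ⟨B₁, c₁, hB₁, hc₁, hmem⟩ := hThm2S_body_of_five_le L hL5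
  refine ⟨B₁, c₁, hB₁, hc₁, fun F hF n K hnK α₀ α₁ hα₀ hα₁ hle U₀ U' h33 h34 hAx h35 => ?_⟩
  obtain ⟨β₀, B₂, len, hT⟩ := hmem F hF n K hnK
  exact oscLetter_of_thm2SetupSUAt F hT hα₀ hα₁ hle U₀ U' h33 h34 hAx h35

end Station

end Summit.QuantumFields.YangMills.Theorems.FluctuationComparisonRegPrIntLS2BetaCovariantOscillationOfThm2

end
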